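import Mathlib
import HarnessLib
import Summits.NavierStokesRegularity.NavierStokesRegularity.Theses.IsobarTomography
import Summits.NavierStokesRegularity.NavierStokesRegularity.Theorems.IsobarTomographyTubeAlternativeLiouvilleGauge

/-!
# Crux `IsobarTomography.TubeAlternative` (stmt-NavierStokesRegularity-11739) — the K2-free restatement

Helper file (theorems only, `--supports` the item) of the line lead (c7). The tree already certifies
(p123074, `tubeAlternative_iff_liouville_imp_typeIForcesBlob`) that the crux D is, with no hypothesis,
`IsobaricLinesLiouville → TypeIForcesBlob`, where `TypeIForcesBlob` (written out verbatim in every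
statement below; it is not a route decl) says that every Type-I maximal Leray–Hopf classical solution
from a rapidly decaying datum satisfies the blob hypothesis. This file records, sorry-free, what the
planner's lateral move needs in order to RESTATE the tube branch as `TypeIForcesBlob` and drop the
Liouville crux K2 (`IsobaricLinesLiouville`) from the route's spine:

* `typeIForcesBlob_of_noTypeIBlowup` / `noTypeIBlowup_of_typeIForcesBlob` /
  `typeIForcesBlob_iff_noTypeIBlowup` — unconditionally `NoTypeIBlowup → TypeIForcesBlob`, and granted
  K1 = `BlobRiccatiClosure` alone, `TypeIForcesBlob ↔ TypeICertificateLadder.NoTypeIBlowup`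
  (the shared item stmt-NavierStokesRegularity-1217);
* `noBlowup_of_typeIForcesBlob` — `NoTypeII ∧ BlobRiccatiClosure ∧ TypeIForcesBlob ⊢ NoBlowup`, the
  route's target WITHOUT `IsobaricLinesLiouville` and WITHOUT `TubeAlternative`;
  the K2-free deciding theorem of a restated route `{NoTypeII, TypeIForcesBlob, BlobRiccatiClosure,
  Assembly}` is then the one-liner `hA (noBlowup_of_typeIForcesBlob hII hB hF)`;
* nothing is lost: inside the present route `D ∧ K2` yields `TypeIForcesBlob`
  (`blob_of_tubeAlternative_of_isobaricLinesLiouville`, p101533) and `TypeIForcesBlob` gives D back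
  (`tubeAlternative_of_typeI_forces_blob`, p101533), so K2 becomes idle for `closes`.

So after restatement the route reads `{NoTypeII, BlobRiccatiClosure, TypeIForcesBlob}`: it splits the
Type-I exclusion `NoTypeIBlowup` into a continuation criterion (K1) and its trigger
(`TypeIForcesBlob`), and K2 becomes an independent Liouville question. References: KNSS, Acta Math. 203
(2009) [KochNadirashviliSereginSverak2009] §1 for the Type-I habitat; the calibration files
`IsobarTomographyTubeAlternativeCalibration.lean` (p121485/p121573) and `…LiouvilleGauge.lean` (p123074).
-/

-- the problem directory repeats the summit name (D-0017); core's `dupNamespace` linter fires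
set_option linter.dupNamespace false

noncomputable section

namespace Summit.NavierStokesRegularity.NavierStokesRegularity.Theorems.TubeAlternative.Restatement

open Set Filter Topology Function MeasureTheory
open Literature.Analysis Literature.Analysis.FluidPDE
open Summit.NavierStokesRegularity.NavierStokesRegularity.Theses
open Summit.NavierStokesRegularity.NavierStokesRegularity.Theses.IsobarTomography
open Summit.NavierStokesRegularity.NavierStokesRegularity.Theorems

/-! ## 1. `TypeIForcesBlob` against the shared Type-I item `NoTypeIBlowup` (stmt-1217) -/

/-- **`NoTypeIBlowup ⟹ TypeIForcesBlob`** (vacuously: a Type-I maximal solution would extend, so the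
antecedent of `TypeIForcesBlob` is void). [folklore] -/
theorem typeIForcesBlob_of_noTypeIBlowup (hX : TypeICertificateLadder.NoTypeIBlowup) :
    (∀ (ν T : ℝ), 0 < ν → 0 < T → ∀ (u : ℝ → EuclideanSpace ℝ (Fin 3) → EuclideanSpace ℝ (Fin 3))
        (p : ℝ → EuclideanSpace ℝ (Fin 3) → ℝ),
      IsMaximalSmoothSolution ν 0 u p T → IsLerayHopfOn T ν 0 (u 0) u →
      HasRapidSpatialDecay (u 0) → IsTypeIBlowup u T →
      ∃ κ : ℝ, 0 < κ ∧ ∃ Ω : ℝ → ℝ, ∃ t₀ ∈ Set.Ico 0 T, ∀ t ∈ Set.Ico t₀ T,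
        (∃ x : EuclideanSpace ℝ (Fin 3), Ω t < ‖curl (u t) x‖) ∧
          ∀ x : EuclideanSpace ℝ (Fin 3), Ω t < ‖curl (u t) x‖ →
            κ * ‖curl (u t) x‖ ^ 2 * Laplacian.laplacian (p t) x ≤
              iteratedFDeriv ℝ 2 (p t) x ![curl (u t) x, curl (u t) x]) := by
  intro ν T hν hT u p hmax hLH hdec hI
  exact absurd (hX ν T hν hT u p hmax.1 hLH hdec hI) hmax.2

/-- **Granted K1, `TypeIForcesBlob ⟹ NoTypeIBlowup`.** A non-extendable Type-I solution is maximal,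
hence blob by `TypeIForcesBlob`, hence extendable by `BlobRiccatiClosure` — contradiction. [folklore] -/
theorem noTypeIBlowup_of_typeIForcesBlob (hB : BlobRiccatiClosure)
    (hF : (∀ (ν T : ℝ), 0 < ν → 0 < T → ∀ (u : ℝ → EuclideanSpace ℝ (Fin 3) → EuclideanSpace ℝ (Fin 3))
        (p : ℝ → EuclideanSpace ℝ (Fin 3) → ℝ),
      IsMaximalSmoothSolution ν 0 u p T → IsLerayHopfOn T ν 0 (u 0) u →
      HasRapidSpatialDecay (u 0) → IsTypeIBlowup u T →
      ∃ κ : ℝ, 0 < κ ∧ ∃ Ω : ℝ → ℝ, ∃ t₀ ∈ Set.Ico 0 T, ∀ t ∈ Set.Ico t₀ T,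
        (∃ x : EuclideanSpace ℝ (Fin 3), Ω t < ‖curl (u t) x‖) ∧
          ∀ x : EuclideanSpace ℝ (Fin 3), Ω t < ‖curl (u t) x‖ →
            κ * ‖curl (u t) x‖ ^ 2 * Laplacian.laplacian (p t) x ≤
              iteratedFDeriv ℝ 2 (p t) x ![curl (u t) x, curl (u t) x])) :
    TypeICertificateLadder.NoTypeIBlowup := by
  intro ν T hν hT u p hcl hLH hdec hI
  by_contra hext
  exact hext (hB ν T hν hT u p hcl hLH hdec (hF ν T hν hT u p ⟨hcl, hext⟩ hLH hdec hI))

/-- **Granted K1, `TypeIForcesBlob ⟺ NoTypeIBlowup` (stmt-NavierStokesRegularity-1217).** So the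
restated tube branch and the blob continuation criterion together are exactly Type-I exclusion in the
Clay class. [folklore] -/
theorem typeIForcesBlob_iff_noTypeIBlowup (hB : BlobRiccatiClosure) :
    (∀ (ν T : ℝ), 0 < ν → 0 < T → ∀ (u : ℝ → EuclideanSpace ℝ (Fin 3) → EuclideanSpace ℝ (Fin 3))
        (p : ℝ → EuclideanSpace ℝ (Fin 3) → ℝ),
      IsMaximalSmoothSolution ν 0 u p T → IsLerayHopfOn T ν 0 (u 0) u →
      HasRapidSpatialDecay (u 0) → IsTypeIBlowup u T →
      ∃ κ : ℝ, 0 < κ ∧ ∃ Ω : ℝ → ℝ, ∃ t₀ ∈ Set.Ico 0 T, ∀ t ∈ Set.Ico t₀ T,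
        (∃ x : EuclideanSpace ℝ (Fin 3), Ω t < ‖curl (u t) x‖) ∧
          ∀ x : EuclideanSpace ℝ (Fin 3), Ω t < ‖curl (u t) x‖ →
            κ * ‖curl (u t) x‖ ^ 2 * Laplacian.laplacian (p t) x ≤
              iteratedFDeriv ℝ 2 (p t) x ![curl (u t) x, curl (u t) x]) ↔
      TypeICertificateLadder.NoTypeIBlowup :=
  ⟨noTypeIBlowup_of_typeIForcesBlob hB, typeIForcesBlob_of_noTypeIBlowup⟩

/-! ## 2. The route's target and deciding theorem WITHOUT K2 and WITHOUT D -/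

/-- **`NoTypeII ∧ K1 ∧ TypeIForcesBlob ⊢ NoBlowup`.** A non-extendable solution is maximal, Type-I by
`NoTypeII`, blob by `TypeIForcesBlob`, extendable by `BlobRiccatiClosure`. The Liouville crux
`IsobaricLinesLiouville` is not used. [folklore] -/
theorem noBlowup_of_typeIForcesBlob (hII : NoTypeII) (hB : BlobRiccatiClosure)
    (hF : (∀ (ν T : ℝ), 0 < ν → 0 < T → ∀ (u : ℝ → EuclideanSpace ℝ (Fin 3) → EuclideanSpace ℝ (Fin 3))
        (p : ℝ → EuclideanSpace ℝ (Fin 3) → ℝ),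
      IsMaximalSmoothSolution ν 0 u p T → IsLerayHopfOn T ν 0 (u 0) u →
      HasRapidSpatialDecay (u 0) → IsTypeIBlowup u T →
      ∃ κ : ℝ, 0 < κ ∧ ∃ Ω : ℝ → ℝ, ∃ t₀ ∈ Set.Ico 0 T, ∀ t ∈ Set.Ico t₀ T,
        (∃ x : EuclideanSpace ℝ (Fin 3), Ω t < ‖curl (u t) x‖) ∧
          ∀ x : EuclideanSpace ℝ (Fin 3), Ω t < ‖curl (u t) x‖ →
            κ * ‖curl (u t) x‖ ^ 2 * Laplacian.laplacian (p t) x ≤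
              iteratedFDeriv ℝ 2 (p t) x ![curl (u t) x, curl (u t) x])) :
    NoBlowup := by
  intro ν T hν hT u p hcl hLH hdec
  by_contra hext
  have hI := hII ν T hν hT u p ⟨hcl, hext⟩ hLH hdec
  exact hext (noTypeIBlowup_of_typeIForcesBlob hB hF ν T hν hT u p hcl hLH hdec hI)

/-! ## 3. Registered tools stub (the conjunction, for `--supports`) -/

/-- **Registered tools stub `stub_restatementTools`** (`ledger workitem stub-add
stmt-NavierStokesRegularity-11739 --name stub_restatementTools`): the conjunction of this file's arrows —
`NoTypeIBlowup → TypeIForcesBlob`; granted K1, `TypeIForcesBlob ↔ NoTypeIBlowup`;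
`NoTypeII → K1 → TypeIForcesBlob → NoBlowup`. A census/calibration stub of the line lead (c7), not a stub of the line's composition. [folklore] -/
theorem stub_restatementTools :
    (Summit.NavierStokesRegularity.NavierStokesRegularity.Theses.TypeICertificateLadder.NoTypeIBlowup → (∀ (ν T : ℝ), 0 < ν → 0 < T → ∀ (u : ℝ → EuclideanSpace ℝ (Fin 3) → EuclideanSpace ℝ (Fin 3)) (p : ℝ → EuclideanSpace ℝ (Fin 3) → ℝ), Literature.Analysis.FluidPDE.IsMaximalSmoothSolution ν 0 u p T → Literature.Analysis.FluidPDE.IsLerayHopfOn T ν 0 (u 0) u → Literature.Analysis.FluidPDE.HasRapidSpatialDecay (u 0) → Literature.Analysis.FluidPDE.IsTypeIBlowup u T → ∃ κ : ℝ, 0 < κ ∧ ∃ Ω : ℝ → ℝ, ∃ t₀ ∈ Set.Ico 0 T, ∀ t ∈ Set.Ico t₀ T, (∃ x : EuclideanSpace ℝ (Fin 3), Ω t < ‖Literature.Analysis.FluidPDE.curl (u t) x‖) ∧ ∀ x : EuclideanSpace ℝ (Fin 3), Ω t < ‖Literature.Analysis.FluidPDE.curl (u t) x‖ → κ * ‖Literature.Analysis.FluidPDE.curl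 (u t) x‖ ^ 2 * Laplacian.laplacian (p t) x ≤ iteratedFDeriv ℝ 2 (p t) x ![Literature.Analysis.FluidPDE.curl (u t) x, Literature.Analysis.FluidPDE.curl (u t) x])) ∧ (Summit.NavierStokesRegularity.NavierStokesRegularity.Theses.IsobarTomography.BlobRiccatiClosure → ((∀ (ν T : ℝ), 0 < ν → 0 < T → ∀ (u : ℝ → EuclideanSpace ℝ (Fin 3) → EuclideanSpace ℝ (Fin 3)) (p : ℝ → EuclideanSpace ℝ (Fin 3) → ℝ), Literature.Analysis.FluidPDE.IsMaximalSmoothSolution ν 0 u p T → Literature.Analysis.FluidPDE.IsLerayHopfOn T ν 0 (u 0) u → Literature.Analysis.FluidPDE.HasRapidSpatialDecay (u 0) → Literature.Analysis.FluidPDE.IsTypeIBlowup u T → ∃ κ : ℝ, 0 < κ ∧ ∃ Ω : ℝ → ℝ, ∃ t₀ ∈ Set.Ico 0 T, ∀ t ∈ Set.Ico t₀ T, (∃ x : EuclideanSpace ℝ (Fin 3), Ω t < ‖Literature.Analysis.FluidPDE.curl (u t) x‖) ∧ ∀ x : EuclideanSpace ℝ (Fin 3), Ω t < ‖Literature.Analysis.FluidPDE.curl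 (u t) x‖ → κ * ‖Literature.Analysis.FluidPDE.curl (u t) x‖ ^ 2 * Laplacian.laplacian (p t) x ≤ iteratedFDeriv ℝ 2 (p t) x ![Literature.Analysis.FluidPDE.curl (u t) x, Literature.Analysis.FluidPDE.curl (u t) x]) ↔ Summit.NavierStokesRegularity.NavierStokesRegularity.Theses.TypeICertificateLadder.NoTypeIBlowup)) ∧ (Summit.NavierStokesRegularity.NavierStokesRegularity.Theses.IsobarTomography.NoTypeII → Summit.NavierStokesRegularity.NavierStokesRegularity.Theses.IsobarTomography.BlobRiccatiClosure → (∀ (ν T : ℝ), 0 < ν → 0 < T → ∀ (u : ℝ → EuclideanSpace ℝ (Fin 3) → EuclideanSpace ℝ (Fin 3)) (p : ℝ → EuclideanSpace ℝ (Fin 3) → ℝ), Literature.Analysis.FluidPDE.IsMaximalSmoothSolution ν 0 u p T → Literature.Analysis.FluidPDE.IsLerayHopfOn T ν 0 (u 0) u → Literature.Analysis.FluidPDE.HasRapidSpatialDecay (u 0) → Literature.Analysis.FluidPDE.IsTypeIBlowup u T → ∃ κ : ℝ, 0 < κ ∧ ∃ Ω : ℝ → ℝ, ∃ t₀ ∈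 Set.Ico 0 T, ∀ t ∈ Set.Ico t₀ T, (∃ x : EuclideanSpace ℝ (Fin 3), Ω t < ‖Literature.Analysis.FluidPDE.curl (u t) x‖) ∧ ∀ x : EuclideanSpace ℝ (Fin 3), Ω t < ‖Literature.Analysis.FluidPDE.curl (u t) x‖ → κ * ‖Literature.Analysis.FluidPDE.curl (u t) x‖ ^ 2 * Laplacian.laplacian (p t) x ≤ iteratedFDeriv ℝ 2 (p t) x ![Literature.Analysis.FluidPDE.curl (u t) x, Literature.Analysis.FluidPDE.curl (u t) x]) → Summit.NavierStokesRegularity.NavierStokesRegularity.Theses.IsobarTomography.NoBlowup) :=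
  ⟨typeIForcesBlob_of_noTypeIBlowup, typeIForcesBlob_iff_noTypeIBlowup,
    fun hII hB hF => noBlowup_of_typeIForcesBlob hII hB hF⟩

end Summit.NavierStokesRegularity.NavierStokesRegularity.Theorems.TubeAlternative.Restatement

end
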